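import Mathlib.RingTheory.MvPolynomial.Homogeneous
import Mathlib.RingTheory.MvPolynomial.Basic
import Mathlib.LinearAlgebra.LinearIndependent.Basic
import Mathlib.Algebra.BigOperators.Finsupp.Basic
import Literature.Computability.MetaComplexity.PolynomialCalculus
import Literature.Computability.MetaComplexity.PolynomialCalculusMultilinear
import HarnessLib

/-!
# Polynomial calculus: the linear-algebra criterion for degree lower bounds (independent top forms)

Companion of `PolynomialCalculus.lean` (Krajíček's PC/F, `PC.DerivableInDegree 𝓕 d`,
`PC.RefutableInDegree`) and `PolynomialCalculusMultilinear.lean` (the multilinearisation operator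
`MLPC.ml`).  The simplest source of PC degree LOWER bounds, valid over every field: a bounded-degree
PC derivation that never has room to multiply is mere linear algebra.

**Theorem** (`PC.not_refutableInDegree_of_linearIndependent_top`).  Let `𝓕 ⊆ F[x̄]`, `d ≥ 1`, and
suppose that the degree-`d` homogeneous components of the multilinearisations `ml A` of the axioms
`A ∈ 𝓕` of degree `≤ d` form a LINEARLY INDEPENDENT family.  Then `𝓕` has no PC/F refutation of
degree `≤ d`.  More precisely (`PC.DerivableInDegree.ml_mem_span_of_linearIndependent`) the
multilinearisation of every line of a degree-`≤ d` derivation lies in the `F`-span of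
`{ml A : A ∈ 𝓕, deg A ≤ d}`: Boolean axioms multilinearise to `0`; a product `f · h` with `h`
non-constant inside degree `d` forces `deg f < d`, hence `(ml f)_d = 0`, hence (independence,
`PC.eq_zero_of_mem_span_of_homogeneousComponent_eq_zero`) `ml f = 0` and `ml (f h) = ml (ml f · h)
= 0`.  Since `(1)_d = 0` but `1 ≠ 0`, the constant `1` is not a line.  A convenient sufficient
condition for the independence (`PC.linearIndependent_top_of_monomials`,
`PC.not_refutableInDegree_of_top_monomials`): the top components are unit multiples of pairwise
distinct monomials.

Typical use (file `Summits/PneNP/PneNP/Theorems/ReslinSizeFromWidthPCDegreeGap.lean`): a CNF all of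
whose clauses have exactly `d` literals on `d` distinct variables, distinct clauses having distinct
variable sets, has no PC/F refutation of degree `≤ d` over any field `F` — e.g. the 2-CNF
`{¬a∨b, ¬b∨c, ¬c∨¬a, a∨d, ¬d∨e, ¬e∨a}` needs PC degree `3` although its resolution width is `2`.

In print the degree-`d` closure as iterated linear algebra is the bounded-degree Gröbner /
"linear closure" view of Clegg–Edmonds–Impagliazzo (STOC 1996, §3); the criterion itself is the
trivial case in which no multiplication step is ever available.  [folklore]

## Mathlib search

`MvPolynomial.homogeneousComponent` (linear; `homogeneousComponent_eq_zero` for `deg < n`),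
`MvPolynomial.totalDegree_mul_of_isDomain`, `MvPolynomial.basisMonomials` (monomials are a basis),
`LinearIndependent.comp` / `.units_smul`, `Finsupp.mem_span_range_iff_exists_finsupp`,
`linearIndependent_iff` — all used as is; no PC-specific material exists in Mathlib.

## Design notes

* Def-free.  The index type of the family is the subtype `{A // A ∈ 𝓕 ∧ A.totalDegree ≤ d}` (axioms
  of larger degree can never be downloaded inside degree `d`).
* The invariant is stated for `ml p`, not `p`: lines need not be multilinear (Krajíček's PC/F keeps
  `x²` until a Boolean axiom is used), but everything a Boolean axiom contributes is killed by `ml`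
  (`MLPC.ml_boolAxiom_mul`).
* Not here: size (monomial counts), PCR twin variables, Nullstellensatz degree.

References: M. Clegg, J. Edmonds, R. Impagliazzo, *Using the Groebner basis algorithm to find
proofs of unsatisfiability*, STOC 1996, §3; J. Krajíček, *Proof Complexity*, CUP 2019, §6.2
(PC/F) [KrajicekProofComplexity2019].
-/

noncomputable section

namespace Literature.Computability.MetaComplexity.PC

open MvPolynomial MLPC

variable {σ : Type*} {F : Type*} [Field F]

/-- **The linear-algebra step.**  If the degree-`d` homogeneous components of a family `v` are
linearly independent, then an element of the span of `v` whose degree-`d` component vanishes is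
`0` (write it as `Σ cᵢ vᵢ`; its top component `Σ cᵢ (vᵢ)_d = 0` forces `c = 0`). [folklore] -/
theorem eq_zero_of_mem_span_of_homogeneousComponent_eq_zero {ι : Type*}
    {v : ι → MvPolynomial σ F} {d : ℕ}
    (H : LinearIndependent F fun i => homogeneousComponent d (v i))
    {m : MvPolynomial σ F} (hm : m ∈ Submodule.span F (Set.range v))
    (h0 : homogeneousComponent d m = 0) : m = 0 := by
  obtain ⟨c, rfl⟩ := Finsupp.mem_span_range_iff_exists_finsupp.1 hm
  have key : (c.sum fun i a => a • homogeneousComponent d (v i)) =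
      homogeneousComponent d (c.sum fun i a => a • v i) := by
    rw [map_finsuppSum]
    simp only [map_smul]
  have hc : c = 0 :=
    linearIndependent_iff.1 H c (by rw [Finsupp.linearCombination_apply, key, h0])
  rw [hc, Finsupp.sum_zero_index]

/-- **Invariant of bounded-degree derivations with independent top forms.**  If the degree-`d`
components of the multilinearised axioms of degree `≤ d` are linearly independent, then the
multilinearisation of every line of a degree-`≤ d` PC/F derivation from `𝓕` lies in the `F`-span
of these multilinearised axioms: the product rule can only ever multiply by constants (a
non-constant factor forces the other factor below degree `d`, where the span has only `ml = 0`),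
and Boolean axioms multilinearise to `0`. (cf. Clegg–Edmonds–Impagliazzo 1996, §3:
the degree-`d` closure by linear algebra) [folklore] -/
theorem DerivableInDegree.ml_mem_span_of_linearIndependent {𝓕 : Set (MvPolynomial σ F)} {d : ℕ}
    (H : LinearIndependent F fun A : {A : MvPolynomial σ F // A ∈ 𝓕 ∧ A.totalDegree ≤ d} =>
      homogeneousComponent d (ml F A.1))
    {p : MvPolynomial σ F} (h : DerivableInDegree 𝓕 d p) :
    ml F p ∈ Submodule.span F
      (Set.range fun A : {A : MvPolynomial σ F // A ∈ 𝓕 ∧ A.totalDegree ≤ d} => ml F A.1) := by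
  induction h with
  | hyp hf hd => exact Submodule.subset_span ⟨⟨_, hf, hd⟩, rfl⟩
  | booleanAxiom j _ =>
    have h0 : ml F (X j ^ 2 - X j : MvPolynomial σ F) = 0 := by
      simpa using ml_boolAxiom_mul (K := F) j (1 : MvPolynomial σ F)
    rw [h0]
    exact Submodule.zero_mem _
  | add _ _ ihf ihg =>
    rw [map_add]
    exact Submodule.add_mem _ ihf ihg
  | @mul f h' hf hd ih =>
    by_cases hh : h'.totalDegree = 0
    · -- multiplication by a constant
      rw [totalDegree_eq_zero_iff_eq_C] at hh
      rw [hh, mul_comm, ← smul_eq_C_mul, map_smul]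
      exact Submodule.smul_mem _ _ ih
    · -- a non-constant factor: the other factor has degree `< d`, so its `ml` vanishes
      by_cases hf0 : f = 0
      · rw [hf0, zero_mul, map_zero]
        exact Submodule.zero_mem _
      have hh0 : h' ≠ 0 := by
        rintro rfl
        exact hh totalDegree_zero
      have hlt : f.totalDegree < d := by
        have := totalDegree_mul_of_isDomain hf0 hh0
        omega
      have hml0 : ml F f = 0 :=
        eq_zero_of_mem_span_of_homogeneousComponent_eq_zero H ih
          (homogeneousComponent_eq_zero _ _ ((totalDegree_ml_le f).trans_lt hlt))
      rw [← ml_ml_mul, hml0, zero_mul, map_zero]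
      exact Submodule.zero_mem _

/-- **Degree lower bounds from independent top forms.**  If `d ≥ 1` and the degree-`d` homogeneous
components of `ml A`, `A ∈ 𝓕` of degree `≤ d`, are linearly independent over `F`, then `𝓕` has no
PC/F refutation of degree `≤ d` (`1` would lie in the span, but `(1)_d = 0` and `1 ≠ 0`).
(cf. Clegg–Edmonds–Impagliazzo 1996, §3) [folklore] -/
theorem not_refutableInDegree_of_linearIndependent_top {𝓕 : Set (MvPolynomial σ F)} {d : ℕ}
    (hd : 1 ≤ d)
    (H : LinearIndependent F fun A : {A : MvPolynomial σ F // A ∈ 𝓕 ∧ A.totalDegree ≤ d} =>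
      homogeneousComponent d (ml F A.1)) :
    ¬ RefutableInDegree 𝓕 d := by
  intro h
  have h' : DerivableInDegree 𝓕 d 1 := h
  have hmem := h'.ml_mem_span_of_linearIndependent H
  rw [ml_one] at hmem
  have h1 : (1 : MvPolynomial σ F) = 0 :=
    eq_zero_of_mem_span_of_homogeneousComponent_eq_zero H hmem
      (homogeneousComponent_eq_zero _ _ (by rw [totalDegree_one]; omega))
  exact one_ne_zero h1

/-- **Sufficient condition for the independence**: the top components are unit multiples of
pairwise distinct monomials (monomials form a basis of `F[x̄]`). [folklore] -/
theorem linearIndependent_top_of_monomials {ι : Type*} {v : ι → MvPolynomial σ F} {d : ℕ}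
    (t : ι → σ →₀ ℕ) (ht : Function.Injective t) (ε : ι → Fˣ)
    (hv : ∀ i, homogeneousComponent d (v i) = (ε i : F) • monomial (t i) 1) :
    LinearIndependent F fun i => homogeneousComponent d (v i) := by
  have h1 : LinearIndependent F fun i => (monomial (t i) (1 : F) : MvPolynomial σ F) := by
    have := (basisMonomials σ F).linearIndependent.comp t ht
    rwa [coe_basisMonomials] at this
  have h2 := h1.units_smul ε
  convert h2 using 1
  funext i
  rw [hv i, Pi.smul_apply', Units.smul_def]

/-- **Degree lower bounds from distinct top monomials** (the form used for CNFs): if `d ≥ 1` and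
every axiom `A ∈ 𝓕` of degree `≤ d` has `(ml A)_d = ε_A · x^{t_A}` with units `ε_A` and pairwise
distinct exponent vectors `t_A`, then `𝓕` has no PC/F refutation of degree `≤ d`. [folklore] -/
theorem not_refutableInDegree_of_top_monomials {𝓕 : Set (MvPolynomial σ F)} {d : ℕ} (hd : 1 ≤ d)
    (t : {A : MvPolynomial σ F // A ∈ 𝓕 ∧ A.totalDegree ≤ d} → σ →₀ ℕ)
    (ht : Function.Injective t)
    (ε : {A : MvPolynomial σ F // A ∈ 𝓕 ∧ A.totalDegree ≤ d} → Fˣ)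
    (htop : ∀ A, homogeneousComponent d (ml F A.1) = (ε A : F) • monomial (t A) 1) :
    ¬ RefutableInDegree 𝓕 d :=
  not_refutableInDegree_of_linearIndependent_top hd (linearIndependent_top_of_monomials t ht ε htop)

end Literature.Computability.MetaComplexity.PC
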